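import Summits.KontsevichZagierPeriods.Zeta5Search.Barrier.ConeGammaS7Defect

/-!
# ζ(5) search — BARRIER: the `S₇` defect of the MODEL saving rate is the F-ENTROPY COCYCLE (closed form)

HONEST FRAMING (cell `pub-zeta5`): systematic search; no irrationality claim unless kernel-certified. MODEL objects
under Brown–Zudilin's (28)+(30) accounting ([BZ22] = arXiv:2210.03391; (28) observed, not proved); nothing here is a
statement about `ζ(5)`, about `γ`, or about the cone's supremum (C2 = `BarrierC2` OPEN). No number or sentence of
record moves (every `γ` of record is a class function; every `Φ`/`C₁`/`C₀` value of record was computed at its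
stated representative). Records in print UNMOVED. Prover P2 g20 (second self-selected Lean-only item, file 2/2).

* `floor_mul_sub_mul_floor`, `abs_floor_mul_sub_mul_floor_le` — `⌊ux⌋ − x⌊u⌋ = x·{u} − {ux} ∈ (−1, x]`;
* `integrableOn_floorDefect` — `u ↦ (⌊ux⌋ − x⌊u⌋)/u²` is integrable on `(0, ∞)` (zero near `0`, `≤ (x+1)u⁻²`);
* `intervalIntegral_floorDefect_eq` — for `x, R > 0`: `∫₀^R (⌊ux⌋ − x⌊u⌋)u⁻² du = x·log x − x·∫_R^{Rx} {w}w⁻² dw`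
  (substitution `w = ux`, `⌊w⌋ = w − {w}`, `∫_R^{Rx} w⁻¹ = log x`);
* **`integral_Ioi_floorDefect`** — `∫₀^∞ (⌊ux⌋ − x⌊u⌋)·u⁻² du = x·log x` for every `x ≥ 0`
  (the remainder is `≤ x|x−1|/((min 1 x)²R) → 0`; improper integral by `intervalIntegral_tendsto_integral_Ioi`);
* **`phi30_permAct`** — THE COCYCLE: for `a` in the closed box and every `g ∈ S₇`,
  **`Φ(g·a) = Φ(a) + Σ_{i∈F} [h_i(g·a)·log h_i(g·a) − h_i(a)·log h_i(a)]`**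
  (insert `∓ h_i·⌊u⌋` using `Σ_{i∈F} h_i(g·a) = Σ_{i∈F} h_i(a)`, then integrate form by form).
So BZ's `Φ` (and, by the group structure `I(ga·n) = I(a·n)·Π_F h(ga·n)!/Π_F h(a·n)!`, also `C₁, C₀, log|λ₁|` — the
latter NOT in the kernel, seat numerics only) is representative-dependent inside an `S₇` class by the F-entropy
cocycle, while `γ` is a class function. NOT here: anything about the critical values under `S₇`, `γ`, the cone's
sup, C2, S-E or `ζ(5)`.
-/

noncomputable section

open Set MeasureTheory Filter
open scoped Topology

namespace Summit.KontsevichZagierPeriods.Zeta5Search.Barrier.ConeGamma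

/-! ### The one-form defect `⌊ux⌋ − x⌊u⌋` -/

/-- `⌊ux⌋ − x⌊u⌋ = x·{u} − {ux}`. -/
theorem floor_mul_sub_mul_floor (x u : ℝ) :
    (⌊u * x⌋ : ℝ) - x * ⌊u⌋ = x * Int.fract u - Int.fract (u * x) := by
  unfold Int.fract
  ring

/-- `|⌊ux⌋ − x⌊u⌋| ≤ x + 1` for `x ≥ 0`. -/
theorem abs_floor_mul_sub_mul_floor_le {x : ℝ} (hx : 0 ≤ x) (u : ℝ) : |(⌊u * x⌋ : ℝ) - x * ⌊u⌋| ≤ x + 1 := by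
  rw [floor_mul_sub_mul_floor, abs_le]
  have h1 := Int.fract_nonneg u
  have h2 := Int.fract_lt_one u
  have h3 := Int.fract_nonneg (u * x)
  have h4 := Int.fract_lt_one (u * x)
  constructor <;> nlinarith

/-- Near `u = 0` the defect vanishes: for `0 ≤ u < 1` with `u·x < 1` (`x ≥ 0`), `⌊ux⌋ − x⌊u⌋ = 0`. -/
theorem floor_mul_sub_mul_floor_eq_zero {x u : ℝ} (hx : 0 ≤ x) (hu0 : 0 ≤ u) (hu1 : u < 1) (hux : u * x < 1) :
    (⌊u * x⌋ : ℝ) - x * ⌊u⌋ = 0 := by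
  rw [Int.floor_eq_zero_iff.mpr ⟨hu0, hu1⟩, Int.floor_eq_zero_iff.mpr ⟨mul_nonneg hu0 hx, hux⟩]
  simp

/-- Measurability of `u ↦ ⌊u·x⌋/u²`. -/
theorem measurable_floor_mul_div_sq (x : ℝ) : Measurable fun u : ℝ => (⌊u * x⌋ : ℝ) / u ^ 2 :=
  ((measurable_of_countable _).comp (measurable_id.mul_const x).floor).div (measurable_id.pow_const 2)

/-- Measurability of the defect integrand. -/
theorem measurable_floorDefect (x : ℝ) : Measurable fun u : ℝ => ((⌊u * x⌋ : ℝ) - x * ⌊u⌋) / u ^ 2 := by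
  refine Measurable.div ?_ (measurable_id.pow_const 2)
  exact ((measurable_of_countable _).comp (measurable_id.mul_const x).floor).sub
    (((measurable_of_countable _).comp measurable_id.floor).const_mul x)

/-- **Integrability on `(0, ∞)`** of `u ↦ (⌊ux⌋ − x⌊u⌋)/u²` (`x ≥ 0`): it vanishes on `(0, 1/(x+1))` and is bounded
by `(x+1)·u⁻²` beyond. -/
theorem integrableOn_floorDefect {x : ℝ} (hx : 0 ≤ x) :
    IntegrableOn (fun u : ℝ => ((⌊u * x⌋ : ℝ) - x * ⌊u⌋) / u ^ 2) (Ioi 0) := by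
  set c : ℝ := 1 / (x + 1) with hc
  have hc0 : 0 < c := by rw [hc]; positivity
  have hc1 : c ≤ 1 := by rw [hc, div_le_one (by linarith)]; linarith
  have hcx : c * x < 1 := by
    rw [hc, div_mul_eq_mul_div, one_mul, div_lt_one (by linarith)]; linarith
  have hsplit : Ioi (0 : ℝ) = Ioo 0 c ∪ Ici c := by
    ext u
    simp only [mem_Ioi, mem_union, mem_Ioo, mem_Ici]
    constructor
    · intro hu
      rcases lt_or_ge u c with h | h
      · exact Or.inl ⟨hu, h⟩
      · exact Or.inr h
    · rintro (⟨hu, _⟩ | h)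
      · exact hu
      · exact hc0.trans_le h
  rw [hsplit]
  refine IntegrableOn.union ?_ ?_
  · refine integrableOn_zero.congr_fun (fun u hu => ?_) measurableSet_Ioo
    have hu1 : u < 1 := hu.2.trans_le hc1
    have hux : u * x < 1 := lt_of_le_of_lt (mul_le_mul_of_nonneg_right hu.2.le hx) hcx
    rw [floor_mul_sub_mul_floor_eq_zero hx hu.1.le hu1 hux, zero_div]
  · have hg : IntegrableOn (fun u : ℝ => (x + 1) * u ^ (-2 : ℝ)) (Ici c) := by
      rw [integrableOn_Ici_iff_integrableOn_Ioi]
      exact (integrableOn_Ioi_rpow_of_lt (by norm_num : (-2 : ℝ) < -1) hc0).const_mul _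
    refine Integrable.mono' hg (measurable_floorDefect x).aestronglyMeasurable ?_
    refine ae_restrict_of_forall_mem measurableSet_Ici fun u hu => ?_
    have hu0 : 0 < u := hc0.trans_le hu
    rw [Real.norm_eq_abs, abs_div, abs_of_pos (pow_pos hu0 2), Real.rpow_neg hu0.le, Real.rpow_two,
      ← div_eq_mul_inv]
    exact div_le_div_of_nonneg_right (abs_floor_mul_sub_mul_floor_le hx u) (pow_pos hu0 2).le

/-! ### Truncated integrals -/

/-- `u ↦ ⌊u·x⌋/u²` is bounded by `x²` on `(0, ∞)` (`x ≥ 0`). -/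
theorem floor_mul_div_sq_le {x u : ℝ} (hx : 0 ≤ x) (hu : 0 < u) : |(⌊u * x⌋ : ℝ) / u ^ 2| ≤ x ^ 2 := by
  have hux : 0 ≤ u * x := mul_nonneg hu.le hx
  rw [abs_div, abs_of_pos (pow_pos hu 2), abs_of_nonneg (by exact_mod_cast Int.floor_nonneg.mpr hux)]
  rcases lt_or_ge (u * x) 1 with h | h
  · rw [Int.floor_eq_zero_iff.mpr ⟨hux, h⟩]; simp; positivity
  · rw [div_le_iff₀ (pow_pos hu 2)]
    have h1 : (⌊u * x⌋ : ℝ) ≤ u * x := Int.floor_le _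
    nlinarith [mul_le_mul_of_nonneg_left h hux]

/-- `u ↦ ⌊u·x⌋/u²` is interval integrable on `[0, R]` (`x ≥ 0`, `R ≥ 0`). -/
theorem intervalIntegrable_floor_mul_div_sq {x R : ℝ} (hx : 0 ≤ x) (hR : 0 ≤ R) :
    IntervalIntegrable (fun u : ℝ => (⌊u * x⌋ : ℝ) / u ^ 2) volume 0 R := by
  rw [intervalIntegrable_iff_integrableOn_Ioc_of_le hR]
  refine Measure.integrableOn_of_bounded (M := x ^ 2) measure_Ioc_lt_top.ne
    (measurable_floor_mul_div_sq x).aestronglyMeasurable ?_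
  refine ae_restrict_of_forall_mem measurableSet_Ioc fun u hu => ?_
  rw [Real.norm_eq_abs]
  exact floor_mul_div_sq_le hx hu.1

/-- `w ↦ ⌊w⌋/w²` is interval integrable on `[0, R]`. -/
theorem intervalIntegrable_floor_div_sq {R : ℝ} (hR : 0 ≤ R) :
    IntervalIntegrable (fun w : ℝ => (⌊w⌋ : ℝ) / w ^ 2) volume 0 R := by
  have h := intervalIntegrable_floor_mul_div_sq zero_le_one hR
  simpa only [mul_one] using h

/-- Substitution: `∫₀^R ⌊ux⌋ u⁻² du = x·∫₀^{Rx} ⌊w⌋ w⁻² dw` (`x > 0`). -/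
theorem intervalIntegral_floor_mul_div_sq_eq {x : ℝ} (hx : 0 < x) (R : ℝ) :
    ∫ u in (0 : ℝ)..R, (⌊u * x⌋ : ℝ) / u ^ 2 = x * ∫ w in (0 : ℝ)..(R * x), (⌊w⌋ : ℝ) / w ^ 2 := by
  have hfun : (fun u : ℝ => (⌊u * x⌋ : ℝ) / u ^ 2) = fun u => (fun w : ℝ => (⌊w⌋ : ℝ) / (w / x) ^ 2) (u * x) := by
    funext u
    simp only [mul_div_cancel_right₀ u hx.ne']
  rw [hfun, intervalIntegral.integral_comp_mul_right (fun w : ℝ => (⌊w⌋ : ℝ) / (w / x) ^ 2) hx.ne', zero_mul,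
    smul_eq_mul]
  have hpt : ∀ w : ℝ, (⌊w⌋ : ℝ) / (w / x) ^ 2 = x ^ 2 * ((⌊w⌋ : ℝ) / w ^ 2) := by
    intro w
    rcases eq_or_ne w 0 with rfl | hw
    · simp
    · field_simp
  simp_rw [hpt]
  rw [intervalIntegral.integral_const_mul]
  field_simp

/-- On an interval of positive reals, `⌊w⌋ w⁻² = w⁻¹ − {w} w⁻²` integrates to `log` minus the fractional part term:
`∫_R^{S} ⌊w⌋ w⁻² dw = log(S/R) − ∫_R^{S} {w} w⁻² dw` (`R, S > 0`). -/
theorem intervalIntegral_floor_div_sq_eq_log_sub {R S : ℝ} (hR : 0 < R) (hS : 0 < S) :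
    ∫ w in R..S, (⌊w⌋ : ℝ) / w ^ 2 = Real.log (S / R) - ∫ w in R..S, Int.fract w / w ^ 2 := by
  have hpos : ∀ w ∈ uIcc R S, 0 < w := fun w hw => (lt_min hR hS).trans_le hw.1
  have hinv : IntervalIntegrable (fun w : ℝ => w⁻¹) volume R S :=
    intervalIntegral.intervalIntegrable_inv (fun w hw => (hpos w hw).ne') continuousOn_id
  have hfl : IntervalIntegrable (fun w : ℝ => (⌊w⌋ : ℝ) / w ^ 2) volume R S :=
    ((intervalIntegrable_floor_div_sq hR.le).symm.trans (intervalIntegrable_floor_div_sq hS.le))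
  have hfr : IntervalIntegrable (fun w : ℝ => Int.fract w / w ^ 2) volume R S := by
    refine (hinv.sub hfl).congr fun w hw => ?_
    have hw0 : w ≠ 0 := (hpos w (uIoc_subset_uIcc hw)).ne'
    have : (w⁻¹ : ℝ) - (⌊w⌋ : ℝ) / w ^ 2 = (w - ⌊w⌋) / w ^ 2 := by field_simp
    simpa only [Int.fract] using this
  rw [← integral_inv_of_pos hR hS, ← intervalIntegral.integral_sub hinv hfr]
  refine intervalIntegral.integral_congr fun w hw => ?_
  have hw0 : w ≠ 0 := (hpos w hw).ne'
  have : (⌊w⌋ : ℝ) / w ^ 2 = w⁻¹ - (w - ⌊w⌋) / w ^ 2 := by field_simp; ring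
  simpa only [Int.fract] using this

/-- **Truncated integral of the defect**: for `x, R > 0`,
`∫₀^R (⌊ux⌋ − x⌊u⌋) u⁻² du = x·log x − x·∫_R^{Rx} {w} w⁻² dw`. -/
theorem intervalIntegral_floorDefect_eq {x R : ℝ} (hx : 0 < x) (hR : 0 < R) :
    ∫ u in (0 : ℝ)..R, ((⌊u * x⌋ : ℝ) - x * ⌊u⌋) / u ^ 2
      = x * Real.log x - x * ∫ w in R..(R * x), Int.fract w / w ^ 2 := by
  have hRx : 0 < R * x := mul_pos hR hx
  have h1 : IntervalIntegrable (fun u : ℝ => (⌊u * x⌋ : ℝ) / u ^ 2) volume 0 R :=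
    intervalIntegrable_floor_mul_div_sq hx.le hR.le
  have h2 : IntervalIntegrable (fun u : ℝ => x * ((⌊u⌋ : ℝ) / u ^ 2)) volume 0 R :=
    (intervalIntegrable_floor_div_sq hR.le).const_mul x
  have hsplit : ∫ u in (0 : ℝ)..R, ((⌊u * x⌋ : ℝ) - x * ⌊u⌋) / u ^ 2
      = (∫ u in (0 : ℝ)..R, (⌊u * x⌋ : ℝ) / u ^ 2) - x * ∫ u in (0 : ℝ)..R, (⌊u⌋ : ℝ) / u ^ 2 := by
    rw [← intervalIntegral.integral_const_mul, ← intervalIntegral.integral_sub h1 h2]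
    refine intervalIntegral.integral_congr fun u _ => ?_
    ring
  rw [hsplit, intervalIntegral_floor_mul_div_sq_eq hx, ← mul_sub,
    intervalIntegral.integral_interval_sub_left (intervalIntegrable_floor_div_sq hRx.le)
      (intervalIntegrable_floor_div_sq hR.le),
    intervalIntegral_floor_div_sq_eq_log_sub hR hRx, mul_div_cancel_left₀ x hR.ne', mul_sub]

/-- The remainder is small: `|x·∫_R^{Rx} {w} w⁻² dw| ≤ x·|x − 1|/((min 1 x)²·R)` (`x, R > 0`). -/
theorem abs_remainder_le {x R : ℝ} (hx : 0 < x) (hR : 0 < R) :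
    |x * ∫ w in R..(R * x), Int.fract w / w ^ 2| ≤ x * |x - 1| / ((min 1 x) ^ 2 * R) := by
  have hm : 0 < min 1 x := lt_min one_pos hx
  have hmR : 0 < min 1 x * R := mul_pos hm hR
  have hbound : ∀ w ∈ Set.uIoc R (R * x), ‖Int.fract w / w ^ 2‖ ≤ 1 / (min 1 x * R) ^ 2 := by
    intro w hw
    have hw1 : min 1 x * R ≤ w := by
      have h := hw.1
      rcases le_total R (R * x) with hle | hle
      · rw [min_eq_left hle] at h
        have : min 1 x * R ≤ R := by nlinarith [min_le_left 1 x]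
        linarith
      · rw [min_eq_right hle] at h
        have : min 1 x * R ≤ R * x := by nlinarith [min_le_right 1 x]
        linarith
    have hw0 : 0 < w := hmR.trans_le hw1
    rw [Real.norm_eq_abs, abs_div, abs_of_pos (pow_pos hw0 2), abs_of_nonneg (Int.fract_nonneg w)]
    calc Int.fract w / w ^ 2 ≤ 1 / w ^ 2 :=
          div_le_div_of_nonneg_right (Int.fract_lt_one w).le (pow_pos hw0 2).le
      _ ≤ 1 / (min 1 x * R) ^ 2 :=
          one_div_le_one_div_of_le (pow_pos hmR 2) (pow_le_pow_left₀ hmR.le hw1 2)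
  have h := intervalIntegral.norm_integral_le_of_norm_le_const hbound
  rw [Real.norm_eq_abs] at h
  rw [abs_mul, abs_of_pos hx]
  calc x * |∫ w in R..(R * x), Int.fract w / w ^ 2| ≤ x * (1 / (min 1 x * R) ^ 2 * |R * x - R|) :=
        mul_le_mul_of_nonneg_left h hx.le
    _ = x * |x - 1| / ((min 1 x) ^ 2 * R) := by
        rw [show R * x - R = R * (x - 1) by ring, abs_mul, abs_of_pos hR]
        field_simp

/-! ### The improper integral -/

/-- **`∫₀^∞ (⌊ux⌋ − x⌊u⌋)·u⁻² du = x·log x`** for every `x ≥ 0` (for `x = 0` both sides vanish; Mathlib's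
`Real.log 0 = 0`). -/
theorem integral_Ioi_floorDefect {x : ℝ} (hx : 0 ≤ x) :
    ∫ u in Ioi (0 : ℝ), ((⌊u * x⌋ : ℝ) - x * ⌊u⌋) / u ^ 2 = x * Real.log x := by
  rcases hx.eq_or_lt with rfl | hx0
  · simp
  have hlim₁ := intervalIntegral_tendsto_integral_Ioi (μ := volume) 0 (integrableOn_floorDefect hx) tendsto_id
  have hrem : Tendsto (fun R : ℝ => x * ∫ w in R..(R * x), Int.fract w / w ^ 2) atTop (𝓝 0) := by
    have hK : Tendsto (fun R : ℝ => x * |x - 1| / (min 1 x) ^ 2 / R) atTop (𝓝 0) :=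
      tendsto_const_nhds.div_atTop tendsto_id
    refine squeeze_zero_norm' ?_ hK
    filter_upwards [eventually_gt_atTop (0 : ℝ)] with R hR
    rw [Real.norm_eq_abs, div_div]
    exact abs_remainder_le hx0 hR
  have hlim₂ : Tendsto (fun R : ℝ => ∫ u in (0 : ℝ)..id R, ((⌊u * x⌋ : ℝ) - x * ⌊u⌋) / u ^ 2) atTop
      (𝓝 (x * Real.log x)) := by
    have h : Tendsto (fun R : ℝ => x * Real.log x - x * ∫ w in R..(R * x), Int.fract w / w ^ 2) atTop
        (𝓝 (x * Real.log x - 0)) := tendsto_const_nhds.sub hrem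
    rw [sub_zero] at h
    refine h.congr' ?_
    filter_upwards [eventually_gt_atTop (0 : ℝ)] with R hR
    exact (intervalIntegral_floorDefect_eq hx0 hR).symm
  exact tendsto_nhds_unique hlim₁ hlim₂

/-! ### The cocycle -/

/-- **THE `S₇` COCYCLE OF THE MODEL SAVING RATE.** For `a` in the closed box and every `g ∈ S₇`,
`Φ(g·a) = Φ(a) + Σ_{i∈F} [h_i(g·a)·log h_i(g·a) − h_i(a)·log h_i(a)]` — `Φ` is representative-dependent inside
an `S₇` class by the F-entropy difference (BZ's printed record value `Φ = 34.394…` is that of the sorted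
representative). -/
theorem phi30_permAct {a : Dir} (ha : BZBox a) (g : Equiv.Perm (Fin 7)) :
    phi30 (permAct g a) = phi30 a
      + ∑ i ∈ FIdx, (h28 (permAct g a) i * Real.log (h28 (permAct g a) i) - h28 a i * Real.log (h28 a i)) := by
  have hga : BZBox (permAct g a) := BZBox_permAct ha g
  have hx : ∀ i, 0 ≤ h28 a i := fun i => h28_nonneg_of_BZBox ha i
  have hy : ∀ i, 0 ≤ h28 (permAct g a) i := fun i => h28_nonneg_of_BZBox hga i
  -- the defect integrand, form by form, with the `∓ h_i ⌊u⌋` insertion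
  set G : Fin 28 → ℝ → ℝ := fun i u =>
    ((⌊u * h28 (permAct g a) i⌋ : ℝ) - h28 (permAct g a) i * ⌊u⌋) / u ^ 2
      - ((⌊u * h28 a i⌋ : ℝ) - h28 a i * ⌊u⌋) / u ^ 2 with hG
  have hGint : ∀ i, IntegrableOn (G i) (Ioi 0) := fun i =>
    (integrableOn_floorDefect (hy i)).sub (integrableOn_floorDefect (hx i))
  have hGval : ∀ i, ∫ u in Ioi (0 : ℝ), G i u
      = h28 (permAct g a) i * Real.log (h28 (permAct g a) i) - h28 a i * Real.log (h28 a i) := by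
    intro i
    rw [hG]
    dsimp only
    rw [integral_sub (integrableOn_floorDefect (hy i)) (integrableOn_floorDefect (hx i)),
      integral_Ioi_floorDefect (hy i), integral_Ioi_floorDefect (hx i)]
  have hpt : ∀ u : ℝ, (∑ i ∈ FIdx, ((⌊u * h28 (permAct g a) i⌋ : ℝ) - ⌊u * h28 a i⌋)) / u ^ 2
      = ∑ i ∈ FIdx, G i u := by
    intro u
    have hsum := sum_FIdx_h28_permAct g a
    simp only [hG, ← sub_div]
    rw [← Finset.sum_div]
    congr 1
    have hterm : ∀ i ∈ FIdx, ((⌊u * h28 (permAct g a) i⌋ : ℝ) - h28 (permAct g a) i * ⌊u⌋)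
        - ((⌊u * h28 a i⌋ : ℝ) - h28 a i * ⌊u⌋)
        = ((⌊u * h28 (permAct g a) i⌋ : ℝ) - ⌊u * h28 a i⌋) - (⌊u⌋ : ℝ) * (h28 (permAct g a) i - h28 a i) := by
      intro i _; ring
    rw [Finset.sum_congr rfl hterm]
    have h2 : ∑ i ∈ FIdx, (((⌊u * h28 (permAct g a) i⌋ : ℝ) - ⌊u * h28 a i⌋)
          - (⌊u⌋ : ℝ) * (h28 (permAct g a) i - h28 a i))
        = ∑ i ∈ FIdx, ((⌊u * h28 (permAct g a) i⌋ : ℝ) - ⌊u * h28 a i⌋)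
          - (⌊u⌋ : ℝ) * ∑ i ∈ FIdx, (h28 (permAct g a) i - h28 a i) := by
      rw [Finset.sum_sub_distrib, ← Finset.mul_sum]
    have h3 : ∑ i ∈ FIdx, (h28 (permAct g a) i - h28 a i) = 0 := by
      rw [Finset.sum_sub_distrib, hsum, sub_self]
    rw [h2, h3, mul_zero, sub_zero]
  rw [← sub_eq_iff_eq_add', phi30_permAct_sub_eq_integral ha g]
  simp_rw [hpt]
  rw [integral_finsetSum _ fun i _ => hGint i]
  exact Finset.sum_congr rfl fun i _ => hGval i

end Summit.KontsevichZagierPeriods.Zeta5Search.Barrier.ConeGamma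

end
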